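import Literature.NumberTheory.EllipticCurves.HeckeNeighbourTransport
import Literature.NumberTheory.EllipticCurves.HeegnerPointsLevelTransport
import HarnessLib

/-!
# The CM point `x/ℓ` above `x = τ_Q`: the level-`N` Heegner form `(ℓ²A, ℓB, C)` of conductor `ℓf`,
# its residue and its Bezout data (Gross 1991 §3: `x_{ℓm} = x_m/ℓ`, `𝒩_n = 𝒩 ∩ 𝒪_n`)

Topic `NumberTheory/EllipticCurves` (complex multiplication), namespace
`Literature.NumberTheory.EllipticCurves`.  Theorems only: no definition, no named fact (D-0026).

For a positive definite form `Q = (A, B, C)` (`A > 0`, `B² − 4AC = D < 0`) and a prime `ℓ`, the form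
`(ℓ²A, ℓB, C)` has root `τ_Q/ℓ = β₀ • τ_Q` (`β₀ = (1 0; 0 ℓ) = tpB ℓ 0`), which is therefore a Hecke
`ℓ`-neighbour of `τ_Q` on `Y₀(N)` (`isHeckeNeighbour_tpB_smul`); it is again a level-`N` Heegner form, of
discriminant `ℓ²D`, as soon as `ℓ ∤ C` (primitivity), with residue `ℓβ` and — when `gcd(ℓ, N) = 1` —
Bezout data `4N(ℓ²c) = (ℓβ)² − ℓ²D`, `u'N + v'(ℓβ) + w'(ℓ²c) = 1` obtained from those of `Q`.  This is the
tree's normalisation `x(n) = x(1)/n` of Gross's Heegner points of conductor `n`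
(`coe_heegnerPointOfConductor_eq_div`, `heegnerPointOfConductor_mul_eq_tpB_smul`: `x(ℓm) = x(m)/ℓ`,
with `𝒩_n = 𝒩 ∩ 𝒪_n`) written for an ARBITRARY base form, so that the Hecke-orbit and trace-relation
theorems of `HeegnerPointsHeckeOrbitOrders*.lean` / `HeegnerTraceRelationOrdersProofs.lean` (which take
the moving point as any primitive Heegner form `Q'` of discriminant `(ℓf)² d_K` in `T_ℓ(τ_Q)`) can be fed
the tower `τ_Q, τ_Q/ℓ₁, τ_Q/(ℓ₁ℓ₂), …` over a CM point of any conductor `f` (e.g. `3 ∣ gcd(N, f)`).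

* `heegnerTau_conductorMul_eq_tpB_smul` — `τ_{(ℓ²A, ℓB, C)} = tpB ℓ 0 • τ_Q` (`= τ_Q/ℓ`);
* `isHeckeNeighbour_heegnerTau_conductorMul` — `τ_Q/ℓ ∈ T_ℓ(τ_Q)`;
* `conductorMul_mem_heegnerForms` — `(ℓ²A, ℓB, C) ∈ heegnerForms N (ℓ²D)` if `Q ∈ heegnerForms N D`, `ℓ ∤ C`;
* `conductorMul_residue`, `conductorMul_bezout` — residue `ℓβ`; Bezout data at conductor `ℓf`.

## References
* B. H. Gross, *Kolyvagin's work on modular elliptic curves*, LMS LNS 153 (1991), §3 (the points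
  `x_n`, `𝒩_n = 𝒩 ∩ 𝒪_n`; PDF p. 215–217 of `book:editornd-l-functions-arithmetic`). [GrossLMS1991]
* B. H. Gross, *Heegner points on `X₀(N)`*, 1984, §I.1 (`𝒪/𝔫 ≅ ℤ/N`). [Gross1984]
* D. A. Cox, *Primes of the form x² + ny²*, 2nd ed. (2013), §2.A, §7.A (primitive forms). [Cox2013]

## Mathlib / tree search
Tree: `heegnerTau`, `heegnerForms`, `coe_heegnerTau` (`HeegnerPoints`); `sqrtDisc`, `sqrtDisc_eq`
(`HeegnerPointsLevelTransport`); `tpB`, `coe_tpB_smul` (`HeckeOperatorsProofs`); `IsHeckeNeighbour`,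
`isHeckeNeighbour_tpB_smul` (`HeckeNeighbourTransport`); `heegnerPointOfConductor_mul_eq_tpB_smul`
(`HeegnerPointsHeckeOrbit`, the `heegnerPointOfConductor` special case).
`lean search 'conductorMul'` → nothing before this file.  presearch: not applicable (elementary algebra of
binary quadratic forms; Gross's normalisation [corpus:book:editornd-l-functions-arithmetic p0216–p0217]).
-/

noncomputable section

open Complex UpperHalfPlane CongruenceSubgroup PeriodPair NumberField
open scoped MatrixGroups

namespace Literature.NumberTheory.EllipticCurves

open Literature.NumberTheory.EllipticCurves.ModularForms
  Literature.NumberTheory.QuadraticFields.BinaryQuadraticForm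
  Literature.NumberTheory.QuadraticFields.Quadratic

/-- `√(f²D) = f√D` for the normalised square roots `sqrtDisc` (`f ≥ 0`). Private helper. [folklore] -/
private theorem sqrtDisc_sq_mul'' (D : ℤ) (f : ℕ) :
    sqrtDisc ((f : ℤ) ^ 2 * D) = (f : ℂ) * sqrtDisc D := by
  unfold sqrtDisc
  have hf : (0 : ℝ) ≤ f := Nat.cast_nonneg f
  have h : -(((f : ℤ) ^ 2 * D : ℤ) : ℝ) = (f : ℝ) ^ 2 * (-(D : ℝ)) := by push_cast; ring
  rw [h, Real.sqrt_mul (sq_nonneg _), Real.sqrt_sq hf]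
  push_cast
  ring

/-! ### The point `x/ℓ`: the form `(ℓ²A, ℓB, C)` of conductor `ℓf` and its Bezout data -/

/-- **`τ_{(ℓ²A, ℓB, C)} = τ_Q/ℓ`** (`= β₀ • τ_Q`, `β₀ = (1 0; 0 ℓ) = tpB ℓ 0`) for a positive definite
form `Q = (A, B, C)`, `A > 0`: both sides are `(−B + √D)/(2ℓA)`.  The CM point `x(𝔫ℓ)` above `x(𝔫)`
(Gross 1991 §3: `x_{ℓm} = x_m/ℓ` in the tree's normalisation `coe_heegnerPointOfConductor_eq_div`).
[cite: GrossLMS1991, §3 (the point x_n)] -/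
theorem heegnerTau_conductorMul_eq_tpB_smul {Q : ℤ × ℤ × ℤ} (hA : 0 < Q.1)
    (hD : Q.2.1 ^ 2 - 4 * Q.1 * Q.2.2 < 0) {ℓ : ℕ} [NeZero ℓ] :
    heegnerTau ((ℓ : ℤ) ^ 2 * Q.1, (ℓ : ℤ) * Q.2.1, Q.2.2) = tpB ℓ 0 • heegnerTau Q := by
  have hℓ0 : (ℓ : ℂ) ≠ 0 := by exact_mod_cast NeZero.ne ℓ
  have hA0 : (Q.1 : ℂ) ≠ 0 := by exact_mod_cast hA.ne'
  have hℓpos : (0 : ℤ) < (ℓ : ℤ) ^ 2 := pow_pos (by exact_mod_cast NeZero.pos ℓ) 2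
  have hA' : 0 < ((ℓ : ℤ) ^ 2 * Q.1, (ℓ : ℤ) * Q.2.1, Q.2.2).1 := mul_pos hℓpos hA
  have hdisc' : ((ℓ : ℤ) ^ 2 * Q.1, (ℓ : ℤ) * Q.2.1, Q.2.2).2.1 ^ 2 -
      4 * ((ℓ : ℤ) ^ 2 * Q.1, (ℓ : ℤ) * Q.2.1, Q.2.2).1 * ((ℓ : ℤ) ^ 2 * Q.1, (ℓ : ℤ) * Q.2.1, Q.2.2).2.2 =
      (ℓ : ℤ) ^ 2 * (Q.2.1 ^ 2 - 4 * Q.1 * Q.2.2) := by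
    simp only
    ring
  have hD' : (ℓ : ℤ) ^ 2 * (Q.2.1 ^ 2 - 4 * Q.1 * Q.2.2) < 0 := mul_neg_of_pos_of_neg hℓpos hD
  have h1 := sqrtDisc_eq hA rfl hD
  have h2 := sqrtDisc_eq hA' hdisc' hD'
  rw [sqrtDisc_sq_mul'', h1] at h2
  simp only [Int.cast_mul, Int.cast_pow, Int.cast_natCast] at h2
  apply UpperHalfPlane.ext
  rw [coe_tpB_smul, Int.cast_zero, add_zero]
  have h2A : (2 * (ℓ : ℂ) * (Q.1 : ℂ)) ≠ 0 := mul_ne_zero (mul_ne_zero two_ne_zero hℓ0) hA0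
  have h3 : (2 * (ℓ : ℂ) * (Q.1 : ℂ)) *
      (((heegnerTau ((ℓ : ℤ) ^ 2 * Q.1, (ℓ : ℤ) * Q.2.1, Q.2.2) : ℍ) : ℂ) * ℓ - heegnerTau Q) = 0 := by
    linear_combination (-1 : ℂ) * h2
  have h4 := sub_eq_zero.mp ((mul_eq_zero.mp h3).resolve_left h2A)
  rw [eq_div_iff hℓ0]
  exact h4

/-- **`x/ℓ ∈ T_ℓ(x)`** for `x = τ_Q`: the root of `(ℓ²A, ℓB, C)` is a Hecke `ℓ`-neighbour of `τ_Q` on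
`Y₀(N)` (`ℓ` prime). [cite: GrossLMS1991, §3 (proof of Prop. 3.7, PDF p. 217)] -/
theorem isHeckeNeighbour_heegnerTau_conductorMul {N : ℕ} [NeZero N] {Q : ℤ × ℤ × ℤ} (hA : 0 < Q.1)
    (hD : Q.2.1 ^ 2 - 4 * Q.1 * Q.2.2 < 0) {ℓ : ℕ} (hℓ : ℓ.Prime) :
    IsHeckeNeighbour N ℓ (heegnerTau Q) (heegnerTau ((ℓ : ℤ) ^ 2 * Q.1, (ℓ : ℤ) * Q.2.1, Q.2.2)) := by
  haveI : NeZero ℓ := ⟨hℓ.ne_zero⟩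
  rw [heegnerTau_conductorMul_eq_tpB_smul hA hD]
  exact isHeckeNeighbour_tpB_smul hℓ _ 0

/-- **The form `(ℓ²A, ℓB, C)` is a level-`N` Heegner form of discriminant `ℓ²D`** when `Q = (A, B, C)`
is one of discriminant `D` and `ℓ ∤ C` (primitivity: a common prime divisor of `ℓ²A, ℓB, C` divides
`C`, hence is not `ℓ`, hence divides `A` and `B`).  For `ℓ` inert in `K` and `ℓ ∤ f` the condition
`ℓ ∤ C` is automatic for `D = f² d_K` (`C = Q(0,1)` is properly represented, so `D` would be a square
mod `ℓ`); it is kept as a hypothesis. [cite: Cox2013, §7.A (primitive forms), Lemma 2.3] -/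
theorem conductorMul_mem_heegnerForms {N : ℕ} {D : ℤ} {Q : ℤ × ℤ × ℤ} (hQ : Q ∈ heegnerForms N D)
    {ℓ : ℕ} (hℓ : ℓ.Prime) (hℓC : ¬ (ℓ : ℤ) ∣ Q.2.2) :
    ((ℓ : ℤ) ^ 2 * Q.1, (ℓ : ℤ) * Q.2.1, Q.2.2) ∈ heegnerForms N ((ℓ : ℤ) ^ 2 * D) := by
  obtain ⟨hdisc, hA, hNA, hprim⟩ := hQ
  refine ⟨by simp only; linear_combination (ℓ : ℤ) ^ 2 * hdisc,
    mul_pos (pow_pos (by exact_mod_cast hℓ.pos) 2) hA, dvd_mul_of_dvd_right hNA _, ?_⟩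
  intro d hdA hdB hdC
  simp only at hdA hdB hdC
  -- reduce to a prime divisor of `d`
  by_contra hd
  have hd' : d.natAbs ≠ 1 := fun h => hd (Int.isUnit_iff_natAbs_eq.mpr h)
  obtain ⟨p, hp, hpd⟩ := Int.exists_prime_and_dvd hd'
  have hpC : p ∣ Q.2.2 := hpd.trans hdC
  have hpℓ : ¬ p ∣ (ℓ : ℤ) := by
    intro h
    have h1 : p.natAbs ∣ ℓ := by simpa using Int.natAbs_dvd_natAbs.mpr h
    rcases (Nat.dvd_prime hℓ).mp h1 with h2 | h2
    · exact (Int.prime_iff_natAbs_prime.mp hp).ne_one h2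
    · apply hℓC
      have h3 : (p.natAbs : ℤ) ∣ Q.2.2 := Int.natAbs_dvd.mpr hpC
      rwa [h2] at h3
  have hpA : p ∣ Q.1 := by
    have h := hpd.trans hdA
    rcases hp.dvd_or_dvd h with h' | h'
    · exact absurd (hp.dvd_of_dvd_pow h') hpℓ
    · exact h'
  have hpB : p ∣ Q.2.1 := by
    have h := hpd.trans hdB
    rcases hp.dvd_or_dvd h with h' | h'
    · exact absurd h' hpℓ
    · exact h'
  exact hp.not_unit (hprim p hpA hpB hpC)

/-- The residue is multiplied by `ℓ`: `ℓB ≡ ℓβ (mod 2N)` — the orientation `𝒩_{ℓf} = 𝒩_f ∩ 𝒪_{ℓf}`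
of the point above (Gross 1991 §3: `𝒩_n = 𝒩 ∩ 𝒪_n`; the tree's `heegnerFormOfConductor` has residue
`nβ`). [cite: GrossLMS1991, §3 (the point x_n: 𝒩_n = 𝒩 ∩ 𝒪_n)] [cite: Gross1984, §I.1] -/
theorem conductorMul_residue {N : ℕ} {Q : ℤ × ℤ × ℤ} {β : ℤ} (hβ : Q.2.1 ≡ β [ZMOD 2 * N]) (ℓ : ℕ) :
    ((ℓ : ℤ) ^ 2 * Q.1, (ℓ : ℤ) * Q.2.1, Q.2.2).2.1 ≡ (ℓ : ℤ) * β [ZMOD 2 * N] :=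
  hβ.mul_left _

/-- **Bezout data propagate from conductor `f` to conductor `ℓf` when `gcd(ℓ, N) = 1`**: from
`4Nc = β² − D`, `uN + vβ + wc = 1` and `aN + bℓ² = 1` one gets `4N(ℓ²c) = (ℓβ)² − ℓ²D` and
`(u + a(vβ + wc))N + (bℓv)(ℓβ) + (bw)(ℓ²c) = 1` — i.e. `𝔫 ∩ 𝒪_{ℓf}` is again a proper ideal of
norm `N` of the smaller order when `gcd(ℓ, N) = 1` (Gross 1984 §I.1, the condition `𝒪/𝔫 ≅ ℤ/N`;
Gross 1991 §3, `𝒩_n = 𝒩 ∩ 𝒪_n` for `n` prime to `N`). [cite: Gross1984, §I.1] [cite: GrossLMS1991, §3 (𝒩_n = 𝒩 ∩ 𝒪_n)] -/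
theorem conductorMul_bezout {N : ℕ} {D β c u v w a b : ℤ} {ℓ : ℕ} (hc : 4 * N * c = β ^ 2 - D)
    (huvw : u * N + v * β + w * c = 1) (hab : a * N + b * (ℓ : ℤ) ^ 2 = 1) :
    4 * N * ((ℓ : ℤ) ^ 2 * c) = ((ℓ : ℤ) * β) ^ 2 - (ℓ : ℤ) ^ 2 * D ∧
      (u + a * (v * β + w * c)) * N + (b * ℓ * v) * ((ℓ : ℤ) * β) + (b * w) * ((ℓ : ℤ) ^ 2 * c) = 1 := by
  refine ⟨by linear_combination (ℓ : ℤ) ^ 2 * hc, ?_⟩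
  linear_combination huvw + (v * β + w * c) * hab

end Literature.NumberTheory.EllipticCurves

end
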